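import Literature.Probability.RandomPlanarGeometry.SAWStripTMInvJoin
import HarnessLib

/-!
# The invariant of the enriched strip transfer matrix, V: `joinH` extends a strand (soundness, part 9)

Topic `Literature/Probability/RandomPlanarGeometry` (soundness of `SAWStripTM.lean`, part 9;
continues `SAWStripTMInvJoin.lean`): the two cases of `joinH` in which exactly one of the two
cells is fresh (`empty`/`stop`, `stop`/`empty`): the strand ending at the other cell is extended
and its far end retargeted.

## References

* I. Jensen, J. Phys. A 37 (2004) 11521–11529, §2.1.
* D. E. Knuth, TAOCP 4A (2011), §7.1.4.
-/

namespace Literature.Probability.RandomPlanarGeometry.SAW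

namespace StripTM

variable {l r0 : ℕ} {cs : List Bool} {u : ℕ} {σ σ' : State} {S : List (List XCell)}

/-! ### `empty` / `stop` -/

/-- `joinH`, case `empty`/`stop`/edge. [folklore] -/
theorem joinH_empty_stop {t : ℕ} {σ : State} (hc : t % l ≠ 0) (ha : σ.slots[t % l - 1]? = some Code.empty)
    {mb : Mate} (hb : σ.slots[t % l]? = some (Code.stop mb)) :
    joinH l t σ true = .next { σ with
      slots := retarget ((σ.slots.set (t % l - 1) (.stop mb)).set (t % l) .inter) mb (.col (t % l - 1))
      gaps := bump σ.gaps (t % l - 1) } := by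
  simp only [joinH, hc, ha, hb, Option.getD_some]
  rfl

/-- `gJoinH`, case `empty`/`stop`/edge. [folklore] -/
theorem gJoinH_empty_stop {t : ℕ} {σ : State} (S : List (List XCell))
    (ha : σ.slots[t % l - 1]? = some Code.empty) {mb : Mate} (hb : σ.slots[t % l]? = some (Code.stop mb)) :
    gJoinH l t σ S true = merge (S ++ [[leftOf l t]]) (leftOf l t) (cellOf l t) := by
  simp [gJoinH, ha, hb]

/-- **Case `empty`/`stop`/edge of `joinH`**: the strand ending at the current cell is extended by
the fresh left cell. [cite: Jensen2004SAWLowerBounds, §2.1] -/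
theorem inv_joinH_empty_stop (hl : 2 ≤ l) (hu : u % 2 = 1) (hI : Inv l r0 cs u σ S)
    (hc1 : 1 ≤ u / 2 % l) (ha : σ.slots[u / 2 % l - 1]? = some Code.empty) {mb : Mate}
    (hb : σ.slots[u / 2 % l]? = some (Code.stop mb)) (hcs : cs.getD u false = true)
    (he : joinH l (u / 2) σ true = .next σ') :
    Inv l r0 cs (u + 1) σ' (gJoinH l (u / 2) σ S true) := by
  have hl0 : 0 < l := by omega
  have hc : u / 2 % l < l := Nat.mod_lt _ hl0
  have hcm : u / 2 % l - 1 < l := by omega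
  have hcs' : u / 2 % l < σ.slots.length := by rw [hI.len_slots]; exact hc
  have hcm' : u / 2 % l - 1 < σ.slots.length := by rw [hI.len_slots]; exact hcm
  have hne : u / 2 % l - 1 ≠ u / 2 % l := by omega
  rw [joinH_empty_stop (by omega) ha hb] at he
  have hsl : σ'.slots = retarget ((σ.slots.set (u / 2 % l - 1) (.stop mb)).set (u / 2 % l) .inter) mb
      (.col (u / 2 % l - 1)) := by cases he; rfl
  have hga : σ'.gaps = bump σ.gaps (u / 2 % l - 1) := by cases he; rfl
  have hsi : σ'.sink = σ.sink := by cases he; rfl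
  rw [gJoinH_empty_stop S ha hb]
  have hvf : cellOf l (u / 2) = front l u (u / 2 % l) := cellOf_eq_front hu
  have hlf : leftOf l (u / 2) = front l u (u / 2 % l - 1) := leftOf_eq_front hu
  have hlnot : leftOf l (u / 2) ∉ cells S := hlf ▸ hI.empty _ hcm ha
  have hA := adj_symm l r0
  have hvreal : (cellOf l (u / 2)).IsReal := by simp [cellOf, XCell.IsReal]
  have hvb : (cellOf l (u / 2), mateCell l u mb) ∈ endPairs S := (hI.ends _ _ hvreal).2 ⟨_, hc, mb, hb, hvf, rfl⟩
  obtain ⟨hW2, h2le2, hcells2, hpairs2, hends2⟩ :=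
    extend_left_spec hI.wf hA hI.two_le hlnot hvb hvreal (adj_leftOf_cellOf hc1)
  have hbv_ne : mateCell l u mb ≠ cellOf l (u / 2) := (ne_of_mem_endPairs' hI.wf hI.two_le hvb).symm
  have hbv_mem : mateCell l u mb ∈ cells S := mem_cells_of_mem_endPairs (endPairs_symm hvb)
  have hmb_lt : ∀ j, mb = .col j → j < l := fun j hj => hI.mate_lt _ j (hj ▸ hb)
  have hmb_c : ∀ j, mb = .col j → j ≠ u / 2 % l := by
    intro j hj e; subst hj; subst e; exact hbv_ne (by simp only [mateCell]; exact hvf.symm)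
  have hmb_cm : ∀ j, mb = .col j → j ≠ u / 2 % l - 1 := by
    intro j hj e; subst hj; subst e; exact hlnot (by rw [hlf]; exact hbv_mem)
  -- the new codes
  have hlook : ∀ k, σ'.slots[k]? = if mb = .col k then some (Code.stop (.col (u / 2 % l - 1)))
      else if k = u / 2 % l then some Code.inter
      else if k = u / 2 % l - 1 then some (Code.stop mb) else σ.slots[k]? := by
    intro k
    rw [hsl, getElem?_retarget]
    cases mb with
    | col j =>
      simp only [Mate.col.injEq, List.length_set]
      by_cases hjk : j = k
      · subst hjk; rw [if_pos rfl, if_pos rfl, if_pos (by rw [hI.len_slots]; exact hmb_lt j rfl)]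
      · rw [if_neg hjk, if_neg hjk, getElem?_set_set hcm' hcs' hne]
    | src => simp only [reduceCtorEq, if_false]; rw [getElem?_set_set hcm' hcs' hne]
    | snk => simp only [reduceCtorEq, if_false]; rw [getElem?_set_set hcm' hcs' hne]
  refine ⟨?_, ?_, ?_, hW2, h2le2, ?_, ?_, ?_, ?_, ?_, ?_, ?_, ?_⟩
  · rw [hsl, length_retarget, List.length_set, List.length_set, hI.len_slots]
  · rw [hga, length_bump, hI.len_gaps]
  · intro k j h
    rw [hlook] at h
    split_ifs at h with h1 h2 h3
    · cases h; exact hcm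
    · cases h
    · cases h; exact hmb_lt j rfl
    · exact hI.mate_lt k j h
  · intro x hx
    rw [hcells2, Finset.mem_insert] at hx
    rcases hx with rfl | hx
    · exact (processed_succ_odd hu _).2 (processed_leftOf_odd hu hl0 hc1)
    · exact (processed_succ_odd hu _).2 (hI.processed x hx)
  · intro a b ha'
    rw [hends2]
    constructor
    · rintro (⟨hab, hne1, hne2⟩ | ⟨rfl, rfl⟩ | ⟨rfl, rfl⟩)
      · obtain ⟨k, hk, m, hkm, rfl, rfl⟩ := (hI.ends_reindex_odd hu ha').1 hab
        refine ⟨k, hk, m, ?_, rfl, rfl⟩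
        rw [hlook, if_neg, if_neg, if_neg]; exact hkm
        · rintro rfl; apply hlnot; rw [hlf, ← front_succ_odd hu hk]; exact mem_cells_of_mem_endPairs hab
        · rintro rfl; exact hne1 (by rw [hvf, front_succ_odd hu hk])
        · intro e; apply hne2; rw [e]; simp only [mateCell]; rw [front_succ_odd hu hk]
      · refine ⟨_, hcm, mb, ?_, by rw [hlf, front_succ_odd hu hcm], (mateCell_succ_odd hu hmb_lt).symm⟩
        rw [hlook, if_neg (fun e => hmb_cm _ e rfl), if_neg hne, if_pos rfl]
      · -- (far end of the current cell, left cell): the far end is real, hence a column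
        cases mb with
        | col j =>
          refine ⟨j, hmb_lt j rfl, .col (u / 2 % l - 1), by rw [hlook, if_pos rfl], ?_, ?_⟩
          · simp only [mateCell]; rw [front_succ_odd hu (hmb_lt j rfl)]
          · simp only [mateCell]; rw [front_succ_odd hu hcm, hlf]
        | src => exact absurd ha' (by simp [mateCell, XCell.IsReal])
        | snk => exact absurd ha' (by simp [mateCell, XCell.IsReal])
    · rintro ⟨k, hk, m, hkm, rfl, rfl⟩
      rw [hlook] at hkm
      split_ifs at hkm with h1 h2 h3
      · cases hkm
        right; right
        refine ⟨?_, ?_⟩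
        · rw [h1]; simp only [mateCell]; rw [front_succ_odd hu hk]
        · simp only [mateCell]; rw [front_succ_odd hu hcm, hlf]
      · cases hkm
      · cases hkm
        right; left
        exact ⟨by rw [h3, front_succ_odd hu hcm, hlf], mateCell_succ_odd hu hmb_lt⟩
      · left
        refine ⟨(hI.ends_reindex_odd hu ha').2 ⟨k, hk, m, hkm, rfl, rfl⟩, ?_, ?_⟩
        · rw [front_succ_odd hu hk, hvf]; intro e; exact h2 (front_inj e)
        · rw [front_succ_odd hu hk]
          cases mb with
          | col j => simp only [mateCell]; intro e; exact h1 (by rw [front_inj e])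
          | src => obtain ⟨r', hr'⟩ := front_eq_cell (l := l) u k; rw [hr']; simp [mateCell]
          | snk => obtain ⟨r', hr'⟩ := front_eq_cell (l := l) u k; rw [hr']; simp [mateCell]
  · intro k hk hk'
    rw [hlook] at hk'
    split_ifs at hk' with h1 h2 h3
    · cases hk'
    · cases hk'
    · cases hk'
    · rw [front_succ_odd hu hk, hcells2, Finset.mem_insert, not_or]
      exact ⟨by rw [hlf]; intro e; exact h3 (front_inj e), hI.empty k hk hk'⟩
  · intro k hk c' hk'
    rw [front_succ_odd hu hk] at hk'
    rw [hlook]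
    split_ifs with h1 h2 h3
    · exfalso
      have : front l u k ∈ cells S := by rw [h1] at hbv_mem; simpa only [mateCell] using hbv_mem
      have := hI.processed _ this; rw [hk'] at this; exact absurd this.1 (by omega)
    · exfalso; subst h2; rw [← hvf, cellOf] at hk'; cases hk'
    · exfalso; subst h3; rw [← hlf, leftOf] at hk'; cases hk'
    · exact hI.dummy k hk c' hk'
  · rw [hcells2, Finset.mem_insert, hI.vsrc_mem, src_time_succ_odd hu]; simp [leftOf]
  · rw [hcells2, Finset.mem_insert, hsi, hI.vsnk_mem]; simp [leftOf]
  · intro p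
    rw [hpairs2, Nat.exists_lt_succ_right, potEdge_of_odd hu, hcs, Finset.mem_insert]
    simp only [true_and]
    constructor
    · rintro ⟨rfl | hp, hreal⟩
      · exact Or.inr rfl
      · exact Or.inl ((hI.pairs_iff p).1 ⟨hp, hreal⟩)
    · rintro (h | rfl)
      · obtain ⟨hp, hreal⟩ := (hI.pairs_iff p).2 h; exact ⟨Or.inr hp, hreal⟩
      · exact ⟨Or.inl rfl, Sym2.ball.2 ⟨by simp [leftOf, XCell.IsReal], hvreal⟩⟩
  · intro k hk
    rw [hga, getElem?_bump, hcount_succ_of_odd hu, hcs, hI.gaps_eq k hk]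
    by_cases hk1 : u / 2 % l - 1 = k
    · rw [if_pos hk1, if_pos ⟨by omega, rfl⟩]; simp only [Option.map_some]; congr 1; omega
    · rw [if_neg hk1, if_neg (by rintro ⟨h, -⟩; omega)]; rfl

/-! ### `stop` / `empty` -/

/-- `joinH`, case `stop`/`empty`/edge. [folklore] -/
theorem joinH_stop_empty {t : ℕ} {σ : State} (hc : t % l ≠ 0) {ma : Mate}
    (ha : σ.slots[t % l - 1]? = some (Code.stop ma)) (hb : σ.slots[t % l]? = some Code.empty) :
    joinH l t σ true = .next { σ with
      slots := retarget ((σ.slots.set (t % l) (.stop ma)).set (t % l - 1) .inter) ma (.col (t % l))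
      gaps := bump σ.gaps (t % l - 1) } := by
  simp only [joinH, hc, ha, hb, Option.getD_some]
  rfl

/-- `gJoinH`, case `stop`/`empty`/edge. [folklore] -/
theorem gJoinH_stop_empty {t : ℕ} {σ : State} (S : List (List XCell)) {ma : Mate}
    (ha : σ.slots[t % l - 1]? = some (Code.stop ma)) (hb : σ.slots[t % l]? = some Code.empty) :
    gJoinH l t σ S true = merge (S ++ [[cellOf l t]]) (leftOf l t) (cellOf l t) := by
  simp [gJoinH, ha, hb]

/-- **Case `stop`/`empty`/edge of `joinH`**: the strand ending at the left cell is extended by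
the fresh current cell. [cite: Jensen2004SAWLowerBounds, §2.1] -/
theorem inv_joinH_stop_empty (hl : 2 ≤ l) (hu : u % 2 = 1) (hI : Inv l r0 cs u σ S)
    (hc1 : 1 ≤ u / 2 % l) {ma : Mate} (ha : σ.slots[u / 2 % l - 1]? = some (Code.stop ma))
    (hb : σ.slots[u / 2 % l]? = some Code.empty) (hcs : cs.getD u false = true)
    (he : joinH l (u / 2) σ true = .next σ') :
    Inv l r0 cs (u + 1) σ' (gJoinH l (u / 2) σ S true) := by
  have hl0 : 0 < l := by omega
  have hc : u / 2 % l < l := Nat.mod_lt _ hl0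
  have hcm : u / 2 % l - 1 < l := by omega
  have hcs' : u / 2 % l < σ.slots.length := by rw [hI.len_slots]; exact hc
  have hcm' : u / 2 % l - 1 < σ.slots.length := by rw [hI.len_slots]; exact hcm
  have hne : u / 2 % l ≠ u / 2 % l - 1 := by omega
  rw [joinH_stop_empty (by omega) ha hb] at he
  have hsl : σ'.slots = retarget ((σ.slots.set (u / 2 % l) (.stop ma)).set (u / 2 % l - 1) .inter) ma
      (.col (u / 2 % l)) := by cases he; rfl
  have hga : σ'.gaps = bump σ.gaps (u / 2 % l - 1) := by cases he; rfl
  have hsi : σ'.sink = σ.sink := by cases he; rfl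
  rw [gJoinH_stop_empty S ha hb]
  have hvf : cellOf l (u / 2) = front l u (u / 2 % l) := cellOf_eq_front hu
  have hlf : leftOf l (u / 2) = front l u (u / 2 % l - 1) := leftOf_eq_front hu
  have hvnot : cellOf l (u / 2) ∉ cells S := hvf ▸ hI.empty _ hc hb
  have hA := adj_symm l r0
  have hlreal : (leftOf l (u / 2)).IsReal := by simp [leftOf, XCell.IsReal]
  have hvreal : (cellOf l (u / 2)).IsReal := by simp [cellOf, XCell.IsReal]
  have hlb : (leftOf l (u / 2), mateCell l u ma) ∈ endPairs S := (hI.ends _ _ hlreal).2 ⟨_, hcm, ma, ha, hlf, rfl⟩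
  obtain ⟨hW2, h2le2, hcells2, hpairs2, hends2⟩ :=
    extend_spec hI.wf hA hI.two_le hlb hlreal hvnot (adj_leftOf_cellOf hc1)
  have hbl_ne : mateCell l u ma ≠ leftOf l (u / 2) := (ne_of_mem_endPairs' hI.wf hI.two_le hlb).symm
  have hbl_mem : mateCell l u ma ∈ cells S := mem_cells_of_mem_endPairs (endPairs_symm hlb)
  have hma_lt : ∀ j, ma = .col j → j < l := fun j hj => hI.mate_lt _ j (hj ▸ ha)
  have hma_cm : ∀ j, ma = .col j → j ≠ u / 2 % l - 1 := by
    intro j hj e; subst hj; subst e; exact hbl_ne (by simp only [mateCell]; exact hlf.symm)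
  have hma_c : ∀ j, ma = .col j → j ≠ u / 2 % l := by
    intro j hj e; subst hj; subst e; exact hvnot (by rw [hvf]; exact hbl_mem)
  have hlook : ∀ k, σ'.slots[k]? = if ma = .col k then some (Code.stop (.col (u / 2 % l)))
      else if k = u / 2 % l - 1 then some Code.inter
      else if k = u / 2 % l then some (Code.stop ma) else σ.slots[k]? := by
    intro k
    rw [hsl, getElem?_retarget]
    cases ma with
    | col j =>
      simp only [Mate.col.injEq, List.length_set]
      by_cases hjk : j = k
      · subst hjk; rw [if_pos rfl, if_pos rfl, if_pos (by rw [hI.len_slots]; exact hma_lt j rfl)]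
      · rw [if_neg hjk, if_neg hjk, getElem?_set_set hcs' hcm' hne]
    | src => simp only [reduceCtorEq, if_false]; rw [getElem?_set_set hcs' hcm' hne]
    | snk => simp only [reduceCtorEq, if_false]; rw [getElem?_set_set hcs' hcm' hne]
  refine ⟨?_, ?_, ?_, hW2, h2le2, ?_, ?_, ?_, ?_, ?_, ?_, ?_, ?_⟩
  · rw [hsl, length_retarget, List.length_set, List.length_set, hI.len_slots]
  · rw [hga, length_bump, hI.len_gaps]
  · intro k j h
    rw [hlook] at h
    split_ifs at h with h1 h2 h3
    · cases h; exact hc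
    · cases h
    · cases h; exact hma_lt j rfl
    · exact hI.mate_lt k j h
  · intro x hx
    rw [hcells2, Finset.mem_insert] at hx
    rcases hx with rfl | hx
    · exact (processed_succ_odd hu _).2 (processed_cellOf_odd hu hl0)
    · exact (processed_succ_odd hu _).2 (hI.processed x hx)
  · intro a b ha'
    rw [hends2]
    constructor
    · rintro (⟨hab, hne1, hne2⟩ | ⟨rfl, rfl⟩ | ⟨rfl, rfl⟩)
      · obtain ⟨k, hk, m, hkm, rfl, rfl⟩ := (hI.ends_reindex_odd hu ha').1 hab
        refine ⟨k, hk, m, ?_, rfl, rfl⟩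
        rw [hlook, if_neg, if_neg, if_neg]; exact hkm
        · rintro rfl; apply hvnot; rw [hvf, ← front_succ_odd hu hk]; exact mem_cells_of_mem_endPairs hab
        · rintro rfl; exact hne1 (by rw [hlf, front_succ_odd hu hk])
        · intro e; apply hne2; rw [e]; simp only [mateCell]; rw [front_succ_odd hu hk]
      · cases ma with
        | col j =>
          refine ⟨j, hma_lt j rfl, .col (u / 2 % l), by rw [hlook, if_pos rfl], ?_, ?_⟩
          · simp only [mateCell]; rw [front_succ_odd hu (hma_lt j rfl)]
          · simp only [mateCell]; rw [front_succ_odd hu hc, hvf]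
        | src => exact absurd ha' (by simp [mateCell, XCell.IsReal])
        | snk => exact absurd ha' (by simp [mateCell, XCell.IsReal])
      · refine ⟨_, hc, ma, ?_, by rw [hvf, front_succ_odd hu hc], (mateCell_succ_odd hu hma_lt).symm⟩
        rw [hlook, if_neg (fun e => hma_c _ e rfl), if_neg hne, if_pos rfl]
    · rintro ⟨k, hk, m, hkm, rfl, rfl⟩
      rw [hlook] at hkm
      split_ifs at hkm with h1 h2 h3
      · cases hkm
        right; left
        refine ⟨?_, ?_⟩
        · rw [h1]; simp only [mateCell]; rw [front_succ_odd hu hk]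
        · simp only [mateCell]; rw [front_succ_odd hu hc, hvf]
      · cases hkm
      · cases hkm
        right; right
        exact ⟨by rw [h3, front_succ_odd hu hc, hvf], mateCell_succ_odd hu hma_lt⟩
      · left
        refine ⟨(hI.ends_reindex_odd hu ha').2 ⟨k, hk, m, hkm, rfl, rfl⟩, ?_, ?_⟩
        · rw [front_succ_odd hu hk, hlf]; intro e; exact h2 (front_inj e)
        · rw [front_succ_odd hu hk]
          cases ma with
          | col j => simp only [mateCell]; intro e; exact h1 (by rw [front_inj e])
          | src => obtain ⟨r', hr'⟩ := front_eq_cell (l := l) u k; rw [hr']; simp [mateCell]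
          | snk => obtain ⟨r', hr'⟩ := front_eq_cell (l := l) u k; rw [hr']; simp [mateCell]
  · intro k hk hk'
    rw [hlook] at hk'
    split_ifs at hk' with h1 h2 h3
    · cases hk'
    · cases hk'
    · cases hk'
    · rw [front_succ_odd hu hk, hcells2, Finset.mem_insert, not_or]
      exact ⟨by rw [hvf]; intro e; exact h3 (front_inj e), hI.empty k hk hk'⟩
  · intro k hk c' hk'
    rw [front_succ_odd hu hk] at hk'
    rw [hlook]
    split_ifs with h1 h2 h3
    · exfalso
      have : front l u k ∈ cells S := by rw [h1] at hbl_mem; simpa only [mateCell] using hbl_mem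
      have := hI.processed _ this; rw [hk'] at this; exact absurd this.1 (by omega)
    · exfalso; subst h2; rw [← hlf, leftOf] at hk'; cases hk'
    · exfalso; subst h3; rw [← hvf, cellOf] at hk'; cases hk'
    · exact hI.dummy k hk c' hk'
  · rw [hcells2, Finset.mem_insert, hI.vsrc_mem, src_time_succ_odd hu]; simp [cellOf]
  · rw [hcells2, Finset.mem_insert, hsi, hI.vsnk_mem]; simp [cellOf]
  · intro p
    rw [hpairs2, Nat.exists_lt_succ_right, potEdge_of_odd hu, hcs, Finset.mem_insert]
    simp only [true_and]
    constructor
    · rintro ⟨rfl | hp, hreal⟩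
      · exact Or.inr rfl
      · exact Or.inl ((hI.pairs_iff p).1 ⟨hp, hreal⟩)
    · rintro (h | rfl)
      · obtain ⟨hp, hreal⟩ := (hI.pairs_iff p).2 h; exact ⟨Or.inr hp, hreal⟩
      · exact ⟨Or.inl rfl, Sym2.ball.2 ⟨hlreal, hvreal⟩⟩
  · intro k hk
    rw [hga, getElem?_bump, hcount_succ_of_odd hu, hcs, hI.gaps_eq k hk]
    by_cases hk1 : u / 2 % l - 1 = k
    · rw [if_pos hk1, if_pos ⟨by omega, rfl⟩]; simp only [Option.map_some]; congr 1; omega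
    · rw [if_neg hk1, if_neg (by rintro ⟨h, -⟩; omega)]; rfl

end StripTM

end Literature.Probability.RandomPlanarGeometry.SAW
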